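import Literature.NumberTheory.EllipticCurves.CyclotomicIwasawaMainTheoremIrreducible
import Literature.NumberTheory.EllipticCurves.PAdicBSDSkinnerUrbanProofs
import HarnessLib

/-!
# bsd.S21′ — the closing step of Burungale–Castella–Skinner's proof of their Thm. 1.1.2 (a)

`Proofs` companion (theorems only: no definition, no new named fact) of
`Literature.NumberTheory.EllipticCurves.CyclotomicIwasawaMainTheoremIrreducible` for the named
fact `Literature.NumberTheory.EllipticCurves.burungale_castella_skinner_charIdeal_eq_padicLFunction`
(**bsd.S21′**; A. Burungale, F. Castella, C. Skinner, *Base change and Iwasawa main conjectures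
for `GL₂`*, Int. Math. Res. Not. IMRN 2025, no. 8, rnaf082 = arXiv:2405.00270v2, Thm. 1.1.2 (a),
p. 2): for `E/ℚ` with good ordinary reduction at `p ≥ 5` and `E[p]` irreducible, `X(E/ℚ_∞)` is
`Λ`-torsion and `ch_Λ X(E/ℚ_∞) = (L_p(E/ℚ))` in `Λ ⊗ ℚ_p`.

## The printed proof, and what this file proves

The fact is **not** discharged here. Its printed proof ("Proof of Theorem 1.1.2", p. 10 of
arXiv:2405.00270v2) runs as follows. Let `g` be the newform of `E`; pick (Lemma 5.2.3) an
imaginary quadratic field `K` and a real quadratic field `F` adapted to `(g, p)`. Prop. 5.2.1 —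
X. Wan's divisibility towards the three-variable main conjecture for `g` over the quartic CM field
`M = FK` (Thm. 3.2.1), descended to `K` through Lemmas 5.1.1–5.1.2 (Skinner–Urban, Props. 3.6–3.7,
Cor. 3.8) — followed by [CGS23, Prop. 1.2.4] and [SU14, Props. 3.6, 3.9] gives the divisibility
(5.3) in `Λ`:
`(L_p(g) · L_p(g_K) · L_p(g_F) · L_p(g_{FK})) ⊇ ch(X(g)) · ch(X(g_K)) · ch(X(g_F)) · ch(X(g_{FK}))`,
the four forms being `g` and its twists by the quadratic characters of `K`, `F`, `FK` (the newforms
of `E` and of three quadratic twists of `E`); and Kato (Astérisque 295, Thm. 17.4) gives (5.4):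
`(L_p(h)) ⊆ ch(X(h))` in `Λ ⊗ ℚ_p` for each of the four forms `h`. "Noting that a proper
divisibility in (5.4) would contradict (5.3), the proof concludes."

None of the inputs of (5.3) (Hida families and Eisenstein congruences on unitary groups over CM
fields, `Λ`-adic Selmer groups over `ℤ_p²`-extensions, two-variable zeta elements) and nothing of
Kato's Euler system is in Mathlib or in the tree: (5.4) for `E` is conclusion 2 of the tree's named
fact `kato_divisibility` (file `PAdicBSD`, undischarged; cf. `KatoDivisibilitySkeletonProofs` for
the algebra of Kato's §17.13), and (5.3) is not vendored (it is not a statement about `E` alone).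
This file PROVES the last sentence of the printed proof and records the exact reduction:

* `Module.charIdeal_ne_bot` — over a domain every characteristic ideal
  `char(M) = ∏ᶠ_{ht 𝔭 = 1} 𝔭^{ℓ_𝔭(M)}` is a nonzero ideal (so its generator can be cancelled).
* `exists_span_eq_and_map_eq_C_zpow_mul_of_prod_mem` — **"a proper divisibility in (5.4) would
  contradict (5.3)"** for a finite family: nonzero `gᵢ ∈ Λ` (generators of the characteristic
  ideals), `Lᵢ ∈ ℚ_p⟦T⟧`, Kato-type inclusions `(Lᵢ) ⊆ (gᵢ)` in `Λ ⊗ ℚ_p` for every `i` and ONE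
  product inclusion `∏ (gᵢ) ⊆ (∏ Lᵢ)` in `Λ ⊗ ℚ_p` force `(gᵢ) = (Lᵢ)` in `Λ ⊗ ℚ_p` for every `i`
  (in the spelling of `PAdicBSD`: `(gᵢ) = (gᵢ')` with `ι gᵢ' = p^{kᵢ} Lᵢ`, `kᵢ ∈ ℤ`). Proof: with
  `g₁ᵢ = tᵢ gᵢ`, `ι g₁ᵢ = p^{aᵢ} Lᵢ` and `p^m ∏ gᵢ = r G`, `ι G = p^n ∏ Lᵢ`, one gets
  `p^{m + Σ aᵢ} = r p^n ∏ tᵢ` in the domain `Λ` (cancel `ι (∏ gᵢ) ≠ 0`), so each `tᵢ` divides a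
  power of the prime element `p` of `Λ` and the one-ideal bookkeeping lemma
  `exists_span_eq_and_map_eq_C_zpow_mul` of `PAdicBSDSkinnerUrbanProofs` (the same step in
  Skinner–Urban's proof of their Thm. 3.6.4) applies to `(gᵢ, g₁ᵢ, G := g₁ᵢ)`.
* `isTorsion_and_charIdeal_eq_of_kato_divisibility_of_prod_le` — the same for a finite family of
  curves `Wᵢ/ℚ` with newforms `fᵢ` and Pontryagin-dual data `Dᵢ` over one `(κ, γ)`:
  `kato_divisibility (Wᵢ) p` for each `i` (conclusions 1–2, `p ≠ 2` good ordinary) and a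
  (5.3)-shaped hypothesis `p^m · ∏ ch(Xᵢ) ⊆ (G)`, `ι G = p^n ∏ L_p(Eᵢ, T)` give, for each `i`,
  `Xᵢ` torsion and `ch(Xᵢ) = (L_p(Eᵢ, T))` in `Λ ⊗ ℚ_p`. For the family `{E, E^K, E^F, E^{FK}}` this
  is literally the last paragraph of the printed proof.
* `burungale_castella_skinner_of_kato_divisibility` — the one-curve form: `kato_divisibility W p`
  and the Burungale–Castella–Skinner direction "`ch(X) ⊆ (L_p(E, T))` in `Λ ⊗ ℚ_p` under the
  hypotheses of Thm. 1.1.2 (a)" (stated inline, in the shape of the hypothesis `hsu` of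
  `skinner_urban_main_conjecture_of_kato_divisibility`; it is what (5.3) and (5.4) for the three
  twists leave of (5.3)) give the conclusion of the named fact at `(W, p, κ, γ, f, D)`; and
  `burungale_castella_skinner_charIdeal_eq_padicLFunction_of_kato_divisibility` — the named fact
  itself from these two inputs universally quantified.

What is deliberately NOT here (D-0026: no new named fact): (5.3), Prop. 5.2.1, Lemma 5.2.3, Wan's
theorem, Kato's theorem; the integral part (b) of Thm. 1.1.2 (condition (im)).

## References

* A. Burungale, F. Castella, C. Skinner, *Base change and Iwasawa main conjectures for `GL₂`*,
  IMRN 2025 (8), rnaf082; arXiv:2405.00270v2: Thm. 1.1.2 (p. 2), §5 (pp. 9–10: Lemmas 5.1.1–5.1.2,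
  Prop. 5.2.1, Lemma 5.2.3, "Proof of Theorem 1.1.2" with (5.2)–(5.4)). [BurungaleCastellaSkinner2025]
* K. Kato, *`p`-adic Hodge theory and values of zeta functions of modular forms*, Astérisque 295
  (2004), Thm. 17.4. [Kato2004Asterisque]
* C. Skinner, E. Urban, *The Iwasawa main conjectures for `GL₂`*, Invent. Math. 195 (2014),
  proof of Thm. 3.6.4 (p. 43), Lem. 3.2. [SkinnerUrban2014]
* L. Washington, *Introduction to Cyclotomic Fields*, GTM 83, §13.1–13.2. [Washington1997]

## Design

Theorems only, `namespace Literature.NumberTheory.EllipticCurves`. Imports the fact's file and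
`PAdicBSDSkinnerUrbanProofs` (for the one-ideal lemma and `IwasawaAlgebra.prime_C` behind it; it
imports only `PAdicBSD`, `IwasawaAlgebraCharIdealProofs` and Mathlib — no cycle).
-/

set_option autoImplicit false

noncomputable section

open scoped Classical MatrixGroups ModularForm

open CongruenceSubgroup WeierstrassCurve Literature.NumberTheory.EllipticCurves.ModularForms

namespace Literature.NumberTheory.EllipticCurves

/-! ### Characteristic ideals are nonzero -/

namespace Module

/-- Over a domain the characteristic ideal `char(M) = ∏ᶠ_{ht 𝔭 = 1} 𝔭 ^ ℓ_𝔭(M)`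
(`Literature.NumberTheory.EllipticCurves.Module.charIdeal`) of ANY module `M` is a nonzero ideal:
it is a finite product of powers of height-one — hence nonzero — primes, or the junk value `1`
(Bourbaki, *Algèbre commutative* VII §4.5; over `Λ = ℤ_p⟦T⟧`: the characteristic power series of
Washington, *Introduction to Cyclotomic Fields*, §13.2, is nonzero). [folklore] -/
theorem charIdeal_ne_bot (R : Type*) [CommRing R] [IsDomain R] (M : Type*) [AddCommGroup M]
    [_root_.Module R M] : charIdeal R M ≠ ⊥ := by
  unfold charIdeal
  refine finprod_mem_induction (fun I : Ideal R => I ≠ ⊥) ?_ (fun I J hI hJ => ?_) ?_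
  · rw [Ideal.one_eq_top]
    exact top_ne_bot
  · exact fun h => (Ideal.mul_eq_bot.mp h).elim hI hJ
  · intro 𝔭 h𝔭 h
    have h1 : 𝔭.asIdeal ≠ ⊥ := Ideal.ne_bot_of_height_eq_one h𝔭
    rcases Nat.eq_zero_or_pos (lengthAt R M 𝔭).toNat with h0 | hpos
    · rw [h0, pow_zero, Ideal.one_eq_top] at h
      exact top_ne_bot h
    · exact h1 ((Ideal.pow_eq_bot hpos.ne').mp h)

end Module

/-! ### "A proper divisibility in (5.4) would contradict (5.3)" — the algebra in `Λ ⊗ ℚ_p` -/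

section Algebra

variable (p : ℕ) [Fact p.Prime]

/-- **No proper divisibility in a product** (the closing sentence of the proof of
Burungale–Castella–Skinner, Thm. 1.1.2, p. 10 of arXiv:2405.00270v2: "Noting that a proper
divisibility in (5.4) would contradict (5.3), the proof concludes"; cf. Skinner–Urban, Lem. 3.2),
in the vocabulary of `PAdicBSD` (`Λ = ℤ_p⟦T⟧`, `ι : Λ ↪ ℚ_p⟦T⟧`, "in `Λ ⊗ ℚ_p`" spelled with
explicit powers of `p`). Let `s` be a finite set of indices, `gᵢ ∈ Λ` nonzero (`hg0`) and
`Lᵢ ∈ ℚ_p⟦T⟧`. Assume, for every `i ∈ s`, Kato's inclusion (5.4) `(Lᵢ) ⊆ (gᵢ)` in `Λ ⊗ ℚ_p`: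
`g₁ᵢ ∈ (gᵢ)` with `ι g₁ᵢ = p^{aᵢ} Lᵢ` (`hg₁`, `hιg₁`); and the product inclusion (5.3)
`∏ᵢ (gᵢ) ⊆ (∏ᵢ Lᵢ)` in `Λ ⊗ ℚ_p`: `p^m ∏ gᵢ ∈ (G)` with `ι G = p^n ∏ Lᵢ` (`hG`, `hιG`). Then
for every `i ∈ s`, `(gᵢ) = (gᵢ')` for some `gᵢ' ∈ Λ` with `ι gᵢ' = p^{kᵢ} Lᵢ`, `kᵢ ∈ ℤ`, i.e.
`(gᵢ) = (Lᵢ)` in `Λ ⊗ ℚ_p`. Proof: writing `g₁ᵢ = tᵢ gᵢ` and `p^m ∏ gᵢ = r G`, one finds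
`p^{m + Σ aᵢ} = r · p^n · ∏ tᵢ` in the domain `Λ` (apply `ι` and cancel `ι (∏ gᵢ) ≠ 0`), so each
`tᵢ` divides a power of the prime element `p` of `Λ`; hence `p^{m + Σ a} gᵢ ∈ (g₁ᵢ)` and the
one-ideal lemma `exists_span_eq_and_map_eq_C_zpow_mul` applies with `G := g₁ᵢ`.
[cite: BurungaleCastellaSkinner2025, Proof of Thm. 1.1.2 (p. 10 of arXiv:2405.00270v2)] -/
theorem exists_span_eq_and_map_eq_C_zpow_mul_of_prod_mem {ι : Type*} {s : Finset ι}
    {g g₁ : ι → IwasawaAlgebra p} {L : ι → PowerSeries ℚ_[p]} {a : ι → ℕ}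
    (hg0 : ∀ i ∈ s, g i ≠ 0) (hg₁ : ∀ i ∈ s, g₁ i ∈ Ideal.span {g i})
    (hιg₁ : ∀ i ∈ s, iwasawaToPowerSeries p (g₁ i) = PowerSeries.C ((p : ℚ_[p]) ^ a i) * L i)
    {m n : ℕ} {G : IwasawaAlgebra p}
    (hG : PowerSeries.C ((p : ℤ_[p]) ^ m) * ∏ i ∈ s, g i ∈ Ideal.span {G})
    (hιG : iwasawaToPowerSeries p G = PowerSeries.C ((p : ℚ_[p]) ^ n) * ∏ i ∈ s, L i)
    {i : ι} (hi : i ∈ s) :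
    ∃ (g' : IwasawaAlgebra p) (k : ℤ), Ideal.span {g i} = Ideal.span {g'} ∧
      iwasawaToPowerSeries p g' = PowerSeries.C ((p : ℚ_[p]) ^ k) * L i := by
  -- `g₁ j = t j * g j` for `j ∈ s`, and `p^m ∏ g = r * G`
  choose! t ht using fun j (hj : j ∈ s) => Ideal.mem_span_singleton'.mp (hg₁ j hj)
  obtain ⟨r, hr⟩ := Ideal.mem_span_singleton'.mp hG
  set ι' := iwasawaToPowerSeries p with hι'
  have hinj : Function.Injective ι' := iwasawaToPowerSeries_injective p
  -- the identity `p^(m + ∑ a) = r * p^n * ∏ t` in the domain `Λ`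
  have key : (PowerSeries.C (p : ℤ_[p]) : IwasawaAlgebra p) ^ (m + ∑ j ∈ s, a j) =
      r * PowerSeries.C (p : ℤ_[p]) ^ n * ∏ j ∈ s, t j := by
    have hprod0 : ι' (∏ j ∈ s, g j) ≠ 0 :=
      (map_ne_zero_iff ι' hinj).mpr (Finset.prod_ne_zero_iff.mpr hg0)
    refine hinj (mul_right_cancel₀ hprod0 ?_)
    have e1 : ι' r * ι' G = (p : PowerSeries ℚ_[p]) ^ m * ∏ j ∈ s, ι' (g j) := by
      rw [← map_mul, hr]
      simp only [map_mul, map_pow, map_prod, map_natCast, hι', iwasawaToPowerSeries]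
    have e2 : (∏ j ∈ s, ι' (t j)) * ∏ j ∈ s, ι' (g j) =
        (p : PowerSeries ℚ_[p]) ^ (∑ j ∈ s, a j) * ∏ j ∈ s, L j := by
      rw [← Finset.prod_mul_distrib, ← Finset.prod_pow_eq_pow_sum, ← Finset.prod_mul_distrib]
      refine Finset.prod_congr rfl fun j hj => ?_
      rw [← map_mul, ht j hj, hιg₁ j hj, map_pow, map_natCast]
    have e3 : ι' G = (p : PowerSeries ℚ_[p]) ^ n * ∏ j ∈ s, L j := by
      rw [hιG, map_pow, map_natCast]
    simp only [map_mul, map_pow, map_prod, map_natCast, hι', iwasawaToPowerSeries]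
    simp only [← hι']
    calc (p : PowerSeries ℚ_[p]) ^ (m + ∑ j ∈ s, a j) * ∏ j ∈ s, ι' (g j)
        = (p : PowerSeries ℚ_[p]) ^ (∑ j ∈ s, a j) *
            ((p : PowerSeries ℚ_[p]) ^ m * ∏ j ∈ s, ι' (g j)) := by ring
      _ = (p : PowerSeries ℚ_[p]) ^ (∑ j ∈ s, a j) *
            (ι' r * ((p : PowerSeries ℚ_[p]) ^ n * ∏ j ∈ s, L j)) := by rw [← e1, e3]
      _ = ι' r * (p : PowerSeries ℚ_[p]) ^ n * ((∏ j ∈ s, ι' (t j)) * ∏ j ∈ s, ι' (g j)) := by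
          rw [e2]; ring
      _ = ι' r * (p : PowerSeries ℚ_[p]) ^ n * (∏ j ∈ s, ι' (t j)) * ∏ j ∈ s, ι' (g j) := by
          ring
  -- hence `t i` divides a power of the prime element `p` of `Λ` …
  have hti : t i ∣ (PowerSeries.C (p : ℤ_[p]) : IwasawaAlgebra p) ^ (m + ∑ j ∈ s, a j) := by
    rw [key]
    exact dvd_mul_of_dvd_right (Finset.dvd_prod_of_mem t hi) _
  obtain ⟨w, hw⟩ := hti
  -- … so that `p^(m + ∑ a) * g i ∈ (g₁ i)`, and the one-ideal lemma applies with `G := g₁ i`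
  have hmem : PowerSeries.C ((p : ℤ_[p]) ^ (m + ∑ j ∈ s, a j)) * g i ∈ Ideal.span {g₁ i} := by
    refine Ideal.mem_span_singleton'.mpr ⟨w, ?_⟩
    rw [← ht i hi, map_pow, hw]
    ring
  exact exists_span_eq_and_map_eq_C_zpow_mul p (hg₁ i hi) (hιg₁ i hi) hmem (hιg₁ i hi)

end Algebra

/-! ### The family form: Kato for each member and (5.3) give the main conjecture for each member -/

section Family

variable (p : ℕ) [Fact p.Prime] {κ : ZpExtension ℚ p} {γ : Field.absoluteGaloisGroup ℚ}

/-- **The last paragraph of the proof of Burungale–Castella–Skinner, Thm. 1.1.2 (a)**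
(arXiv:2405.00270v2, p. 10), for a finite family of curves. Let `Wᵢ/ℚ` (`i ∈ s`) be globally
minimal Weierstrass equations, `p ≠ 2` a prime good ordinary for every `Wᵢ` (`hord`), `ℚ_∞/ℚ` the
cyclotomic `ℤ_p`-extension `κ` with topological generator `γ` matching the cyclotomic variable
(`hκ`, `hγ`, `hγ'`), `fᵢ` the newform of `Wᵢ` (`hf`), `Lᵢ = L_p(Eᵢ, T) = padicLFunction fᵢ αᵢ` and
`Xᵢ = Dᵢ.X` the Iwasawa module of the datum `Dᵢ`. Assume
* (5.4) for every member: Kato's theorem `kato_divisibility (Wᵢ) p` (Kato 2004, Thm. 17.4;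
  conclusions 1–2: `Xᵢ` is `Λ`-torsion and `p^{aᵢ} Lᵢ ∈ ι(ch Xᵢ)`), and
* (5.3) for the family, in `Λ ⊗ ℚ_p`: `p^m · ∏ᵢ ch(Xᵢ) ⊆ (G)` for some `G ∈ Λ` with
  `ι G = p^n · ∏ᵢ Lᵢ` (`hG`, `hιG`).
Then for every `i ∈ s`: `Xᵢ` is `Λ`-torsion and `ch(Xᵢ) = (Lᵢ)` in `Λ ⊗ ℚ_p`, i.e. `ch(Xᵢ) = (g)`
with `ι g = p^k Lᵢ`, `k ∈ ℤ`. In the printed proof `s = {g, g_K, g_F, g_{FK}}` indexes `E` and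
three quadratic twists, (5.3) comes from Prop. 5.2.1 (Wan's divisibility over `M = FK`, base
change) with [CGS23, Prop. 1.2.4], [SU14, Props. 3.6, 3.9], and (5.4) is [Kat04, Thm. 17.4]; neither
is proved here — they are the hypotheses. The characteristic ideals are principal
(`charIdeal_isPrincipal_holds`, `Λ` a UFD) and nonzero (`Module.charIdeal_ne_bot`), and the algebra
is `exists_span_eq_and_map_eq_C_zpow_mul_of_prod_mem`.
[cite: BurungaleCastellaSkinner2025, Proof of Thm. 1.1.2 (p. 10 of arXiv:2405.00270v2)] -/
theorem isTorsion_and_charIdeal_eq_of_kato_divisibility_of_prod_le {ι : Type*} {s : Finset ι}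
    (W : ι → WeierstrassCurve ℚ) [∀ i, (W i).IsGloballyMinimal]
    {N : ι → ℕ} [∀ i, NeZero (N i)] {f : ∀ i, CuspForm (Gamma0 (N i)) 2}
    (hkato : ∀ i ∈ s, kato_divisibility (W i) p (κ := κ) (γ := γ) (f := f i))
    (hp : p ≠ 2) (hord : ∀ i ∈ s, IsOrdinaryAt (W i) p) (hκ : κ.IsCyclotomic)
    (hγ : κ.IsTopGenerator γ) (hγ' : IsCyclotomicVariable p γ)
    (hf : ∀ i ∈ s, IsNewformOf (W i) (f i)) (D : ∀ i, (W i).SelmerDualData κ γ)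
    {m n : ℕ} {G : IwasawaAlgebra p}
    (hG : Ideal.span {PowerSeries.C ((p : ℤ_[p]) ^ m)} * ∏ i ∈ s, (D i).charIdeal ≤ Ideal.span {G})
    (hιG : iwasawaToPowerSeries p G =
      PowerSeries.C ((p : ℚ_[p]) ^ n) * ∏ i ∈ s, padicLFunction (f i) (unitRoot (W i) p : ℚ_[p]))
    {i : ι} (hi : i ∈ s) :
    (D i).IsTorsion ∧ ∃ (g : IwasawaAlgebra p) (k : ℤ), (D i).charIdeal = Ideal.span {g} ∧
      iwasawaToPowerSeries p g =
        PowerSeries.C ((p : ℚ_[p]) ^ k) * padicLFunction (f i) (unitRoot (W i) p : ℚ_[p]) := by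
  -- generators `c j` of the (principal, nonzero) characteristic ideals
  have hgen : ∀ j, ∃ c : IwasawaAlgebra p, (D j).charIdeal = Ideal.span {c} := fun j => by
    haveI : (Module.charIdeal (IwasawaAlgebra p) (D j).X).IsPrincipal :=
      charIdeal_isPrincipal_holds p (D j).X
    exact Submodule.IsPrincipal.principal (Module.charIdeal (IwasawaAlgebra p) (D j).X)
  choose c hc using hgen
  have hc0 : ∀ j ∈ s, c j ≠ 0 := fun j _ h0 =>
    Module.charIdeal_ne_bot (IwasawaAlgebra p) (D j).X (by
      change (D j).charIdeal = ⊥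
      rw [hc j, h0, Ideal.span_singleton_eq_bot])
  -- (5.4) for each member: torsion, and `g₁ j ∈ (c j)` with `ι (g₁ j) = p^{a j} L j`
  have hK : ∀ j ∈ s, (D j).IsTorsion ∧ ∃ (a : ℕ) (g₁ : IwasawaAlgebra p),
      g₁ ∈ Ideal.span {c j} ∧ iwasawaToPowerSeries p g₁ =
        PowerSeries.C ((p : ℚ_[p]) ^ a) * padicLFunction (f j) (unitRoot (W j) p : ℚ_[p]) := by
    intro j hj
    obtain ⟨htors, ⟨a, g₁, hg₁, hι⟩, -⟩ := hkato j hj hp (hord j hj) hκ hγ hγ' (hf j hj) (D j)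
    exact ⟨htors, a, g₁, hc j ▸ hg₁, hι⟩
  choose! a g₁ hg₁ hιg₁ using fun j (hj : j ∈ s) => (hK j hj).2
  refine ⟨(hK i hi).1, ?_⟩
  -- (5.3) on the generators
  have hGmem : PowerSeries.C ((p : ℤ_[p]) ^ m) * ∏ j ∈ s, c j ∈ Ideal.span {G} := by
    refine hG (Ideal.mul_mem_mul (Ideal.mem_span_singleton_self _) (Ideal.prod_mem_prod ?_))
    intro j _
    rw [hc j]
    exact Ideal.mem_span_singleton_self _
  obtain ⟨g', k, hspan, hι⟩ :=
    exists_span_eq_and_map_eq_C_zpow_mul_of_prod_mem p hc0 hg₁ hιg₁ hGmem hιG hi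
  exact ⟨g', k, (hc i).trans hspan, hι⟩

end Family

/-! ### bsd.S21′ from bsd.S20 (Kato) and the Burungale–Castella–Skinner direction -/

section OneCurve

variable (p : ℕ) [Fact p.Prime] {κ : ZpExtension ℚ p} {γ : Field.absoluteGaloisGroup ℚ}

/-- **bsd.S21′ at one datum, from Kato's divisibility and the opposite divisibility.** Let `E/ℚ`
(globally minimal `W`), `p`, `κ`, `γ`, `f` be as in
`burungale_castella_skinner_charIdeal_eq_padicLFunction`, `X = D.X`,
`L = L_p(E, T) = padicLFunction f (unitRoot W p)`, `ι : Λ ↪ ℚ_p⟦T⟧`. Assume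
* `hkato`: Kato's theorem `kato_divisibility W p` (Kato 2004, Thm. 17.4; (5.4) of
  Burungale–Castella–Skinner): for `p ≠ 2` good ordinary, `X` is `Λ`-torsion and `p^a L = ι g₁`
  with `g₁ ∈ ch X`;
* `hbcs`: the Burungale–Castella–Skinner direction under the hypotheses of their Thm. 1.1.2 (a)
  (`p ≥ 5` good ordinary, `E[p]` irreducible): `ch X ⊆ (L)` in `Λ ⊗ ℚ_p` — there are `m, n ≥ 0`
  and `G ∈ Λ` with `ι G = p^n L` and `p^m · ch X ⊆ (G)`. This is what the divisibility (5.3)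
  (Prop. 5.2.1 with [CGS23, Prop. 1.2.4], [SU14, Props. 3.6, 3.9]) together with (5.4) for the three
  twists `g_K, g_F, g_{FK}` leaves for `E` itself ("Proof of Theorem 1.1.2", p. 10); it is not
  discharged in the tree and is stated here inline, in the shape of the hypothesis `hsu` of
  `skinner_urban_main_conjecture_of_kato_divisibility`.
Then the conclusion of bsd.S21′ holds at `(W, p, κ, γ, f, D)`: `X` is torsion (Kato) and
`ch X = (g)` with `ι g = p^k L`, `k ∈ ℤ` (`exists_span_eq_and_map_eq_C_zpow_mul`; `ch X` is
principal by `charIdeal_isPrincipal_holds`, and `IsOrdinaryAt W p` is `hgood ∧ hord`).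
[cite: BurungaleCastellaSkinner2025, Thm. 1.1.2 (a) and its proof (pp. 2, 10 of arXiv:2405.00270v2)] -/
theorem burungale_castella_skinner_of_kato_divisibility (W : WeierstrassCurve ℚ)
    [W.IsGloballyMinimal] {N : ℕ} [NeZero N] {f : CuspForm (Gamma0 N) 2}
    (hkato : kato_divisibility W p (κ := κ) (γ := γ) (f := f))
    (hbcs : ∀ (_hp : 5 ≤ p) (_hgood : W.HasGoodReductionAtPrime p)
      (_hord : ¬ (p : ℤ) ∣ W.frobeniusTrace p) (_hirr : W.HasIrreducibleModPGaloisRep p)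
      (_hκ : κ.IsCyclotomic) (_hγ : κ.IsTopGenerator γ) (_hγ' : IsCyclotomicVariable p γ)
      (_hf : IsNewformOf W f) (D : W.SelmerDualData κ γ),
      ∃ (m n : ℕ) (G : IwasawaAlgebra p),
        iwasawaToPowerSeries p G =
            PowerSeries.C ((p : ℚ_[p]) ^ n) * padicLFunction f (unitRoot W p : ℚ_[p]) ∧
          ∀ x ∈ D.charIdeal, PowerSeries.C ((p : ℤ_[p]) ^ m) * x ∈ Ideal.span {G})
    (hp : 5 ≤ p) (hgood : W.HasGoodReductionAtPrime p) (hord : ¬ (p : ℤ) ∣ W.frobeniusTrace p)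
    (hirr : W.HasIrreducibleModPGaloisRep p) (hκ : κ.IsCyclotomic) (hγ : κ.IsTopGenerator γ)
    (hγ' : IsCyclotomicVariable p γ) (hf : IsNewformOf W f) (D : W.SelmerDualData κ γ) :
    D.IsTorsion ∧ ∃ (g : IwasawaAlgebra p) (k : ℤ), D.charIdeal = Ideal.span {g} ∧
      iwasawaToPowerSeries p g =
        PowerSeries.C ((p : ℚ_[p]) ^ k) * padicLFunction f (unitRoot W p : ℚ_[p]) := by
  have hp2 : p ≠ 2 := by omega
  obtain ⟨htors, ⟨a, g₁, hg₁, hιg₁⟩, -⟩ := hkato hp2 ⟨hgood, hord⟩ hκ hγ hγ' hf D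
  obtain ⟨m, n, G, hιG, hG⟩ := hbcs hp hgood hord hirr hκ hγ hγ' hf D
  -- a generator `g` of the (principal) characteristic ideal
  haveI : (Module.charIdeal (IwasawaAlgebra p) D.X).IsPrincipal := charIdeal_isPrincipal_holds p D.X
  obtain ⟨g, hg⟩ := Submodule.IsPrincipal.principal (Module.charIdeal (IwasawaAlgebra p) D.X)
  have hchar : D.charIdeal = Ideal.span {g} := hg
  rw [hchar] at hg₁ hG
  obtain ⟨g', k, hspan, hι⟩ := exists_span_eq_and_map_eq_C_zpow_mul p hg₁ hιg₁
    (hG g (Ideal.mem_span_singleton_self g)) hιG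
  exact ⟨htors, g', k, hchar.trans hspan, hι⟩

end OneCurve

/-- **bsd.S21′ (Burungale–Castella–Skinner, Thm. 1.1.2 (a)) from bsd.S20 (Kato) and the
Burungale–Castella–Skinner direction, as named facts/hypotheses universally quantified.** If
Kato's theorem `kato_divisibility W p` (Kato 2004, Thm. 17.4 = (5.4)) holds for every elliptic
curve `E/ℚ` (globally minimal `W`), prime `p`, `κ`, `γ` and `f`, and the opposite divisibility
"`ch X(E/ℚ_∞) ⊆ (L_p(E, T))` in `Λ ⊗ ℚ_p`" holds under the hypotheses of Thm. 1.1.2 (a) (`p ≥ 5`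
good ordinary, `E[p]` irreducible; the content of §5 of the source: (5.3) from Wan's divisibility by
base change, with (5.4) for the twists), then the named fact
`burungale_castella_skinner_charIdeal_eq_padicLFunction` holds. This records the exact trust base of
a future discharge: `kato_divisibility` and a vendoring of (5.3)/Prop. 5.2.1; the algebra between
them is `burungale_castella_skinner_of_kato_divisibility`.
[cite: BurungaleCastellaSkinner2025, Thm. 1.1.2 (a) and its proof (pp. 2, 10 of arXiv:2405.00270v2)] -/
theorem burungale_castella_skinner_charIdeal_eq_padicLFunction_of_kato_divisibility
    (hkato : ∀ (W : WeierstrassCurve ℚ) [W.IsElliptic] [W.IsGloballyMinimal] (p : ℕ) [Fact p.Prime]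
      (κ : ZpExtension ℚ p) (γ : Field.absoluteGaloisGroup ℚ) (N : ℕ) [NeZero N]
      (f : CuspForm (Gamma0 N) 2), kato_divisibility W p (κ := κ) (γ := γ) (f := f))
    (hbcs : ∀ (W : WeierstrassCurve ℚ) [W.IsElliptic] [W.IsGloballyMinimal] (p : ℕ) [Fact p.Prime]
      (κ : ZpExtension ℚ p) (γ : Field.absoluteGaloisGroup ℚ) (N : ℕ) [NeZero N]
      (f : CuspForm (Gamma0 N) 2) (_hp : 5 ≤ p) (_hgood : W.HasGoodReductionAtPrime p)
      (_hord : ¬ (p : ℤ) ∣ W.frobeniusTrace p) (_hirr : W.HasIrreducibleModPGaloisRep p)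
      (_hκ : κ.IsCyclotomic) (_hγ : κ.IsTopGenerator γ) (_hγ' : IsCyclotomicVariable p γ)
      (_hf : IsNewformOf W f) (D : W.SelmerDualData κ γ),
      ∃ (m n : ℕ) (G : IwasawaAlgebra p),
        iwasawaToPowerSeries p G =
            PowerSeries.C ((p : ℚ_[p]) ^ n) * padicLFunction f (unitRoot W p : ℚ_[p]) ∧
          ∀ x ∈ D.charIdeal, PowerSeries.C ((p : ℤ_[p]) ^ m) * x ∈ Ideal.span {G}) :
    burungale_castella_skinner_charIdeal_eq_padicLFunction := by
  intro W _ _ p _ κ γ N _ f hp hgood hord hirr hκ hγ hγ' hf D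
  exact burungale_castella_skinner_of_kato_divisibility p W (hkato W p κ γ N f) (hbcs W p κ γ N f)
    hp hgood hord hirr hκ hγ hγ' hf D

end Literature.NumberTheory.EllipticCurves

end
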